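import Summits.QuantumFields.YangMills.Theorems.UnitScaleTiltMinimiserStabilityRegPrThm1Induction
import HarnessLib

/-!
# Route `UnitScaleTilt`, crux K1 child «MinimiserStabilityRegPr» (stmt-QuantumFields-19200), registered stub `stub_minSixAttained` (V5) of the
# layer-4 v4 birth (828f5fb4a904d3be): ATTAINMENT OVER (6)(ε₀) IS IMPLIED BY THE TWO OTHER PRINTED LEAVES V3 (Prop 7 from a background (14),
# global reading R1 of «minimal orbit») AND V2 (`B11.Prop8Printed`) AT THE SAME `B₃` — PROVED; hence v3d's `stub_variational` from THREE leaves

Cell `ym3-torus` ∕ fleet seat `ym-ust-19200-p2` (HUMAN RULING D-0037, YM ladder rung R3).  WHAT THIS IS NOT: nothing of Bałaban's analysis is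
proved — Proposition 7 (as proved in print from a background with (14), Sects. B–E) and Proposition 8 (Sect. F pp.300–304) are HYPOTHESES, in the
registered shapes of `stub_prop7From14` (one `B₃ > 4`, `C₁ = L³`, `O₁ ≥ 1`) and `B11.Prop8Printed B₃ (T3Thm1Carrier.famX L)`.  WHAT IS PROVED:
the located schema `T3ExistSplit.MinSixAttainedAt L â₀ â₁ B₃` (gap G-K1aR-2′: the infimum of the Wilson action over print's relatively open regular
fibre (6)(ε₀) is ATTAINED, for (7)-data at `0 < ε₁ ≤ â₁` and every `ε₀ ∈ [B₃ε₁, â₀]`) FOLLOWS from those two leaves, with `â₁ = a₁ :=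
min{a₁′, a₅/(O₁L³B₃)}` and `â₀ = O₁L³B₃·a₁`.  The point is that the carrier `T3Thm1Carrier.varProblem3` types Prop 7's second clause in the GLOBAL
reading R1 (`OnMinimalOrbit e V U` = `U` minimises the Wilson action over the WHOLE regular fibre at radius `e = O₁L³B₃ε₁`), and that radius is
at our disposal through `ε₁`:
* LOW WINDOW `B₃ε₁ ≤ ε₀ ≤ O₁L³B₃ε₁`: the background of Sect. A at `ε₁` (induction on `k = K − n`, `background_T3'` below — the sibling
  `Variational.background_T3` minus its idle Sect. F hypothesis) and Prop 7's second clause give a GLOBAL minimiser `U` over (6)(O₁L³B₃ε₁); it is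
  critical in reading R2, so Prop 8 (`O₁L³B₃ε₁ ≤ a₅`) puts it in (8)(B₃ε₁) ⊆ (6)(ε₀) ⊆ (6)(O₁L³B₃ε₁), and a minimiser over the big set lying in
  the small set minimises over the middle one;
* HIGH WINDOW `O₁L³B₃ε₁ < ε₀ ≤ O₁L³B₃a₁`: the datum is (7)-small at the LARGER `ε₁′ := ε₀/(O₁L³B₃) ∈ (ε₁, a₁]`, so the background at `ε₁′` and
  Prop 7's second clause at `ε₁′` give a global minimiser over (6)(O₁L³B₃ε₁′) = (6)(ε₀) itself.
So the v4 skeleton's fifth stub is REDUNDANT given its second and third: `stub_variational_of_three_leaves` is p444663's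
`stub_variational_of_leaves` with the attainment leaf discharged (V5 ⇐ V2 ∧ V3; V4 = Sect. F enters only through Theorem 1's regularity clause).

* §1 `isMinOn_big_mem_small_of_background_T3` — from a background with (14): a GLOBAL minimiser over (6)(O₁L³B₃ε₁) lying in (8)(B₃ε₁) (Prop 7 ∧ Prop 8).
* §2 `background_T3'` — Sect. A's background supply (induction on `k`), from Prop 7 ∧ Prop 8 only.
* §3 **`minSixAttainedAt_of_prop7_prop8`** (V5 ⇐ V3 ∧ V2 at one `B₃ > 4`); **`stub_variational_of_three_leaves`**.

References: T. Bałaban, CMP 102 (1985) 277–309 [Balaban1985Variational] (Thm 1 p.279, Sect. A (11)–(14) pp.279–280, Prop 7 and (142) p.299,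
Prop 8 p.304).
-/

noncomputable section

namespace Summit.QuantumFields.YangMills.Theorems.Variational

open Literature.MathematicalPhysics.QuantumFieldTheory.Balaban1983to89
open T3ContinuumYM3Torus T3LowerAlongMinimisersSplit T3AvgDivergenceSplit T3ExistSplit T3Thm1Carrier T3SectASteps
open T3PrintedRegularMinimiser T3PrintedMinimiserExistence T3ConstrainedMinimiser
open T3UnitLawDensityEML (ℰp)
open B11 (Prop8Printed SectFPrinted)

/-! ## §1 From a background with (14): a global minimiser over the big fibre lying in the small one -/

/-- **PROP 7 (second clause, global reading R1) ∧ PROP 8 FROM A BACKGROUND WITH (14)**, at one d = 3 carrier: for a (7)-datum `V` of height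
`n < K`, `0 < ε₁ ≤ a₁` (`a₁ ≤ a₁′`, `a₁ ≤ a₅/(O₁L³B₃)`, `O₁ ≥ 1`, `B₃ > 0`) and a background `U₀ ∈ 𝔘_k(L³B₃ε₁)` with `Ū₀ = V`, there is `U` in
the SMALL fibre (8)(B₃ε₁) which minimises the Wilson action over the BIG fibre (6)(O₁L³B₃ε₁) (Prop 7's minimal orbit is critical in reading R2,
and Prop 8 applies since `O₁L³B₃ε₁ ≤ a₅`). [cite: Balaban1985Variational, Prop. 7 p.299 and Prop. 8 p.304] -/
theorem isMinOn_big_mem_small_of_background_T3 {L : ℕ} (hL : 1 < L) {B₃ a₀ a₁' O₁ a₅ a₁ : ℝ} (hB₃ : 0 < B₃) (hO₁ : 1 ≤ O₁)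
    (h1 : a₁ ≤ a₁') (h3 : a₁ ≤ a₅ / (O₁ * (L : ℝ) ^ 3 * B₃))
    (H7 : ∀ (i : Idx L) (ε₀ ε₁ : ℝ), 0 < ε₁ → ∀ V : (famX L i).Bdry, (famX L i).Reg7 ε₁ V →
      ∀ U₀ : (famX L i).Cfg, (famX L i).InU ((L : ℝ) ^ 3 * B₃ * ε₁) U₀ → (famX L i).InB V U₀ →
        (ε₀ ≤ a₀ → B₃ * ε₁ ≤ ε₀ → (famX L i).AtMostOneCriticalOrbit ε₀ V) ∧
        (ε₁ ≤ a₁' → ∃ U : (famX L i).Cfg, (famX L i).OnMinimalOrbit (O₁ * (L : ℝ) ^ 3 * B₃ * ε₁) V U))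
    (H8 : ∀ (i : Idx L) (ε₀ ε₁ : ℝ), 0 < ε₁ → ∀ (V : (famX L i).Bdry) (U : (famX L i).Cfg),
      (famX L i).Reg7 ε₁ V → (famX L i).InU ε₀ U → (famX L i).InB V U → (famX L i).IsCritical V U → ε₀ ≤ a₅ → (famX L i).InU (B₃ * ε₁) U)
    (F : T3Family) (hF : F.L = L) {n K : ℕ} (hnK : n < K) {ε₁ : ℝ} (hε₁ : 0 < ε₁) (hε₁a : ε₁ ≤ a₁)
    (V : GaugeField (F.P n) 0 (Matrix.specialUnitaryGroup (Fin 2) ℂ)) (hV : PlaqSmall ε₁ V)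
    (U₀ : GaugeField (F.P K) 0 (Matrix.specialUnitaryGroup (Fin 2) ℂ)) (hU₀ : RegPr F n K ((L : ℝ) ^ 3 * B₃ * ε₁) U₀)
    (hU₀B : U₀ ∈ fibre F ℰp n K hnK.le V) :
    ∃ U ∈ regFibrePr F n K hnK.le (B₃ * ε₁) V,
      IsMinOn (fun W : GaugeField (F.P K) 0 (Matrix.specialUnitaryGroup (Fin 2) ℂ) => wilsonAction4 W)
        (regFibrePr F n K hnK.le (O₁ * (L : ℝ) ^ 3 * B₃ * ε₁) V) U := by
  have hL1 : (1 : ℝ) ≤ L := by exact_mod_cast hL.le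
  have hK : 0 < O₁ * (L : ℝ) ^ 3 * B₃ := by positivity
  have hbig : 0 < O₁ * (L : ℝ) ^ 3 * B₃ * ε₁ := mul_pos hK hε₁
  -- Prop 8's window: `O₁L³B₃ε₁ ≤ a₅`
  have hε₀a₅ : O₁ * (L : ℝ) ^ 3 * B₃ * ε₁ ≤ a₅ := by
    have hKa : a₁ * (O₁ * (L : ℝ) ^ 3 * B₃) ≤ a₅ := (le_div_iff₀ hK).1 h3
    nlinarith [mul_le_mul_of_nonneg_left hε₁a hK.le]
  -- Prop 7, second clause: a global minimiser over the big fibre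
  obtain ⟨U, hU⟩ := (H7 ⟨(F, n, K), hF, hnK⟩ a₀ ε₁ hε₁ V hV U₀ hU₀ hU₀B).2 (hε₁a.trans h1)
  obtain ⟨hUmem, hUmin⟩ := (onMinimalOrbit_iff _ V U).mp hU
  -- it is critical in reading R2, so Prop 8 puts it in (8)(B₃ε₁)
  have hcrit : (famX L ⟨(F, n, K), hF, hnK⟩).IsCritical V U := ⟨_, hbig, hUmem, hUmin⟩
  have hIn : (famX L ⟨(F, n, K), hF, hnK⟩).InU (O₁ * (L : ℝ) ^ 3 * B₃ * ε₁) U := ((mem_regFibrePr_iff F).mp hUmem).2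
  have hB : (famX L ⟨(F, n, K), hF, hnK⟩).InB V U := hUmem.1.1
  have h8U : RegPr F n K (B₃ * ε₁) U := H8 ⟨(F, n, K), hF, hnK⟩ _ ε₁ hε₁ V U hV hIn hB hcrit hε₀a₅
  exact ⟨U, (mem_regFibrePr_iff F).mpr ⟨hB, h8U⟩, hUmin⟩

/-! ## §2 The background supply of Sect. A from Prop 7 ∧ Prop 8 only -/

/-- **THE BACKGROUND SUPPLY OF SECT. A** for the d = 3 carriers (induction on `k = K − n`; p. 279 «Theorem 1 will be proved by induction with respect
to k», (11)–(14) pp. 279–280), from Prop 7-from-(14) and Prop 8 ONLY (`B₃ > 4` for the `k = 1` background «U₀ = V₀», `T3SectASteps.sat14_base`;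
for `k + 1` the (8)-member produced by §1 at height `n + 1` over `V₀ = secTo V`, lifted by (12)–(13), `mem_regFibrePr_height_succ`, `C₁ = L³`) —
the sibling `Variational.background_T3` without its Sect. F hypothesis. [cite: Balaban1985Variational, Sect. A (11)-(14) pp.279-280] -/
theorem background_T3' {L : ℕ} (hL : 1 < L) {B₃ a₀ a₁' O₁ a₅ a₁ : ℝ} (hB₃ : 4 < B₃) (hO₁ : 1 ≤ O₁)
    (h1 : a₁ ≤ a₁') (h3 : a₁ ≤ a₅ / (O₁ * (L : ℝ) ^ 3 * B₃))
    (H7 : ∀ (i : Idx L) (ε₀ ε₁ : ℝ), 0 < ε₁ → ∀ V : (famX L i).Bdry, (famX L i).Reg7 ε₁ V →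
      ∀ U₀ : (famX L i).Cfg, (famX L i).InU ((L : ℝ) ^ 3 * B₃ * ε₁) U₀ → (famX L i).InB V U₀ →
        (ε₀ ≤ a₀ → B₃ * ε₁ ≤ ε₀ → (famX L i).AtMostOneCriticalOrbit ε₀ V) ∧
        (ε₁ ≤ a₁' → ∃ U : (famX L i).Cfg, (famX L i).OnMinimalOrbit (O₁ * (L : ℝ) ^ 3 * B₃ * ε₁) V U))
    (H8 : ∀ (i : Idx L) (ε₀ ε₁ : ℝ), 0 < ε₁ → ∀ (V : (famX L i).Bdry) (U : (famX L i).Cfg),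
      (famX L i).Reg7 ε₁ V → (famX L i).InU ε₀ U → (famX L i).InB V U → (famX L i).IsCritical V U → ε₀ ≤ a₅ → (famX L i).InU (B₃ * ε₁) U) :
    ∀ (k : ℕ) (F : T3Family), F.L = L → ∀ (n K : ℕ) (hnK : n < K), K - n = k + 1 → ∀ ε₁ : ℝ, 0 < ε₁ → ε₁ ≤ a₁ →
      ∀ V : GaugeField (F.P n) 0 (Matrix.specialUnitaryGroup (Fin 2) ℂ), PlaqSmall ε₁ V →
        ∃ U₀ : GaugeField (F.P K) 0 (Matrix.specialUnitaryGroup (Fin 2) ℂ),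
          RegPr F n K ((L : ℝ) ^ 3 * B₃ * ε₁) U₀ ∧ U₀ ∈ fibre F ℰp n K hnK.le V := by
  have hB₃0 : 0 < B₃ := by linarith
  intro k
  induction k with
  | zero =>
    -- `k = 1`: «we take simply U₀ = V₀»
    intro F hF n K hnK hk ε₁ hε₁ _ V hV
    have hK : K = n + 1 := by omega
    subst hK
    have hFL : ((F.L : ℕ) : ℝ) = (L : ℝ) := by rw [hF]
    obtain ⟨hreg, hfib⟩ := sat14_base F n hB₃ hε₁ hV
    rw [hFL] at hreg
    exact ⟨secTo F n (n + 1) (Nat.le_succ n) V, hreg, hfib⟩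
  | succ k ih =>
    -- `k ↦ k + 1`: the (8)-member at height `n + 1` over `V₀ = secTo V`, lifted by (12)–(13)
    intro F hF n K hnK hk ε₁ hε₁ hε₁a V hV
    have hnK' : n + 1 < K := by omega
    have hFL : ((F.L : ℕ) : ℝ) = (L : ℝ) := by rw [hF]
    have hV₀reg : PlaqSmall ε₁ (secTo F n (n + 1) (Nat.le_succ n) V) := plaqSmall_secTo F (Nat.le_succ n) hε₁ hV
    -- the inductive hypothesis at height `n + 1`, then §1 there
    obtain ⟨U₁, hU₁, hU₁B⟩ := ih F hF (n + 1) K hnK' (by omega) ε₁ hε₁ hε₁a _ hV₀reg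
    obtain ⟨U', hU'mem, -⟩ := isMinOn_big_mem_small_of_background_T3 hL hB₃0 hO₁ h1 h3 H7 H8 F hF hnK' hε₁ hε₁a _ hV₀reg U₁ hU₁ hU₁B
    -- (12)–(13): the lift to the height `n`, `C₁ = L³`
    have h13 := mem_regFibrePr_height_succ F hnK'.le (mul_pos hB₃0 hε₁).le hU'mem
    obtain ⟨hfib, hreg⟩ := (mem_regFibrePr_iff F).mp h13
    refine ⟨U', ?_, hfib⟩
    rw [← hFL, mul_assoc]
    exact hreg

/-! ## §3 Attainment over (6)(ε₀) from Prop 7-from-(14) and Prop 8; the stub from three leaves -/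

/-- **V5 ⇐ V3 ∧ V2 — ATTAINMENT OVER PRINT'S REGULAR FIBRE (6)(ε₀) FROM PROP 7-FROM-(14) (global reading R1) AND PROP 8 AT THE SAME `B₃ > 4`**:
with `a₁ := min{a₁′, a₅/(O₁L³B₃)}`, `â₁ := a₁`, `â₀ := O₁L³B₃·a₁`: for every member `F` of block size `L`, heights `n < K`, `0 < ε₁ ≤ â₁`,
`B₃ε₁ ≤ ε₀ ≤ â₀` and every (7)-datum `V`, the Wilson action attains its infimum over `regFibrePr F n K _ ε₀ V` — in the LOW window
`ε₀ ≤ O₁L³B₃ε₁` at the global minimiser over (6)(O₁L³B₃ε₁), which lies in (8)(B₃ε₁) ⊆ (6)(ε₀) by Prop 8; in the HIGH window `O₁L³B₃ε₁ < ε₀`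
at the global minimiser over (6)(O₁L³B₃ε₁′) = (6)(ε₀) for `ε₁′ := ε₀/(O₁L³B₃) ≥ ε₁` (the datum is (7)-small at `ε₁′`); backgrounds from
`background_T3'`.  = the registered stub `stub_minSixAttained` (`T3ExistSplit.MinSixAttainedAt`, located gap G-K1aR-2′) DISCHARGED from the
two printed leaves. [cite: Balaban1985Variational, Prop. 7 p.299 and Prop. 8 p.304] -/
theorem minSixAttainedAt_of_prop7_prop8 {L : ℕ} (hL : 1 < L) {B₃ : ℝ} (hB₃ : 4 < B₃)
    (H7 : ∃ a₀ a₁' O₁ : ℝ, 0 < a₀ ∧ 0 < a₁' ∧ 1 ≤ O₁ ∧ ∀ (i : Idx L) (ε₀ ε₁ : ℝ), 0 < ε₁ → ∀ V : (famX L i).Bdry, (famX L i).Reg7 ε₁ V →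
      ∀ U₀ : (famX L i).Cfg, (famX L i).InU ((L : ℝ) ^ 3 * B₃ * ε₁) U₀ → (famX L i).InB V U₀ →
        (ε₀ ≤ a₀ → B₃ * ε₁ ≤ ε₀ → (famX L i).AtMostOneCriticalOrbit ε₀ V) ∧
        (ε₁ ≤ a₁' → ∃ U : (famX L i).Cfg, (famX L i).OnMinimalOrbit (O₁ * (L : ℝ) ^ 3 * B₃ * ε₁) V U))
    (H8 : Prop8Printed B₃ (famX L)) :
    ∃ â₀ â₁ : ℝ, 0 < â₀ ∧ 0 < â₁ ∧ MinSixAttainedAt L â₀ â₁ B₃ := by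
  obtain ⟨a₀, a₁', O₁, ha₀, ha₁', hO₁, H7⟩ := H7
  obtain ⟨a₅, ha₅, H8⟩ := H8
  have hB₃0 : 0 < B₃ := by linarith
  have hL1 : (1 : ℝ) ≤ L := by exact_mod_cast hL.le
  have hK : 0 < O₁ * (L : ℝ) ^ 3 * B₃ := by positivity
  -- the final `a₁`
  set a₁ : ℝ := min a₁' (a₅ / (O₁ * (L : ℝ) ^ 3 * B₃)) with ha₁_def
  have ha₁ : 0 < a₁ := lt_min ha₁' (div_pos ha₅ hK)
  have h1 : a₁ ≤ a₁' := min_le_left _ _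
  have h3 : a₁ ≤ a₅ / (O₁ * (L : ℝ) ^ 3 * B₃) := min_le_right _ _
  have hbg := background_T3' hL hB₃ hO₁ h1 h3 H7 H8
  refine ⟨O₁ * (L : ℝ) ^ 3 * B₃ * a₁, a₁, mul_pos hK ha₁, ha₁, ?_⟩
  intro F hF n K hnK ε₁ ε₀ hε₁ hε₁a hlo hhi V hV
  by_cases hcase : ε₀ ≤ O₁ * (L : ℝ) ^ 3 * B₃ * ε₁
  · -- LOW window: the global minimiser over (6)(O₁L³B₃ε₁) lies in (8)(B₃ε₁) ⊆ (6)(ε₀)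
    obtain ⟨U₀, hU₀, hU₀B⟩ := hbg (K - n - 1) F hF n K hnK (by omega) ε₁ hε₁ hε₁a V hV
    obtain ⟨U, hU8, hUmin⟩ :=
      isMinOn_big_mem_small_of_background_T3 hL hB₃0 hO₁ h1 h3 H7 H8 F hF hnK hε₁ hε₁a V hV U₀ hU₀ hU₀B
    exact ⟨U, regFibrePr_mono F hlo V hU8, hUmin.on_subset (regFibrePr_mono F hcase V)⟩
  · -- HIGH window: the datum is (7)-small at `ε₁′ := ε₀/(O₁L³B₃) ∈ (ε₁, a₁]`
    rw [not_le] at hcase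
    have hε₀ : 0 < ε₀ := (mul_pos hK hε₁).trans hcase
    set ε₁' : ℝ := ε₀ / (O₁ * (L : ℝ) ^ 3 * B₃) with hε₁'_def
    have hε₁' : 0 < ε₁' := div_pos hε₀ hK
    have hε₁le : ε₁ ≤ ε₁' := by
      rw [hε₁'_def, le_div_iff₀ hK]
      nlinarith
    have hε₁'a : ε₁' ≤ a₁ := by
      rw [hε₁'_def, div_le_iff₀ hK]
      nlinarith
    have heq : O₁ * (L : ℝ) ^ 3 * B₃ * ε₁' = ε₀ := by
      rw [hε₁'_def]
      field_simp
    have hV' : PlaqSmall ε₁' V := plaqSmall_of_le hε₁le hV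
    obtain ⟨U₀, hU₀, hU₀B⟩ := hbg (K - n - 1) F hF n K hnK (by omega) ε₁' hε₁' hε₁'a V hV'
    obtain ⟨U, hU⟩ := (H7 ⟨(F, n, K), hF, hnK⟩ a₀ ε₁' hε₁' V hV' U₀ hU₀ hU₀B).2 (hε₁'a.trans h1)
    obtain ⟨hUmem, hUmin⟩ := (onMinimalOrbit_iff _ V U).mp hU
    rw [heq] at hUmem hUmin
    exact ⟨U, hUmem, hUmin⟩

/-- **THE v3d BODY OF `stub_variational` FROM THREE LEAVES** (V3 Prop 7-from-(14), V2 `B11.Prop8Printed`, V4 `B11.SectFPrinted` at one `B₃ > 4`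
for every admissible block size): p444663's `stub_variational_of_leaves` with its fourth leaf (attainment over (6)(ε₀), `T3ExistSplit.MinSixAttainedAt`)
DISCHARGED by `minSixAttainedAt_of_prop7_prop8`.  The registered v4 skeleton's `stub_minSixAttained` is therefore redundant given `stub_prop7From14`
and `stub_prop8`: `variational_of_leaves` may be fed by V2, V3, V4 alone. [cite: Balaban1985Variational, Thm 1 p.279, Prop 7 p.299, Prop 8 p.304] -/
theorem stub_variational_of_three_leaves
    (hyp : ∀ L : ℕ, 1 < L → ∃ B₃ : ℝ, 4 < B₃ ∧
      (∃ a₀ a₁' O₁ : ℝ, 0 < a₀ ∧ 0 < a₁' ∧ 1 ≤ O₁ ∧ ∀ (i : Idx L) (ε₀ ε₁ : ℝ), 0 < ε₁ → ∀ V : (famX L i).Bdry, (famX L i).Reg7 ε₁ V →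
        ∀ U₀ : (famX L i).Cfg, (famX L i).InU ((L : ℝ) ^ 3 * B₃ * ε₁) U₀ → (famX L i).InB V U₀ →
          (ε₀ ≤ a₀ → B₃ * ε₁ ≤ ε₀ → (famX L i).AtMostOneCriticalOrbit ε₀ V) ∧
          (ε₁ ≤ a₁' → ∃ U : (famX L i).Cfg, (famX L i).OnMinimalOrbit (O₁ * (L : ℝ) ^ 3 * B₃ * ε₁) V U)) ∧
      Prop8Printed B₃ (famX L) ∧ SectFPrinted B₃ (famX L)) :
    ∀ (L : ℕ), ∃ a₀ a₁ B₃ B₄ : ℝ, 0 < a₀ ∧ 0 < a₁ ∧ 0 < B₃ ∧ 0 < B₄ ∧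
      MinSixAttainedAt L a₀ a₁ B₃ ∧ MinimisersIn8At L a₀ a₁ B₃ ∧ MinimiserCurvGradAt L a₀ a₁ B₃ B₄ := by
  refine stub_variational_of_leaves fun L hL => ?_
  obtain ⟨B₃, hB₃, H7, H8, HF⟩ := hyp L hL
  exact ⟨B₃, hB₃, H7, H8, HF, minSixAttainedAt_of_prop7_prop8 hL hB₃ H7 H8⟩

end Summit.QuantumFields.YangMills.Theorems.Variational

end
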